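import Literature.AlgebraicGeometry.Motives.MixedHodgeStructureEndomorphismAlgebra
import Literature.AlgebraicGeometry.Motives.MixedHodgeStructureAbelianUniversal
import Literature.AlgebraicGeometry.Motives.MixedHodgeStructureSubobjects
import Mathlib.RingTheory.Idempotents
import Mathlib.RingTheory.Jacobson.Ideal
import Mathlib.RingTheory.Artinian.Module
import HarnessLib

/-!
# Corner algebras of `End_MHS(H)`: `e · End_MHS(H) · e ≅ End_MHS(eH)` for an idempotent endomorphism `e`

Lam, *A First Course in Noncommutative Rings*, §21 «The theory of idempotents»: the Peirce decomposition
`R = eRe ⊕ eRf ⊕ fRe ⊕ fRf` (21.3), the corner rings `eRe = {r : er = r = re}` ((21.4)); (21.7) Corollary: «For any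
idempotent `e ∈ R`, there is a natural ring isomorphism `End_R(eR) ≅ eRe`»; (21.8): `eR` is indecomposable iff the
corner ring `eRe` has no nontrivial idempotents ("primitive idempotent"); (21.9): `eR` is strongly indecomposable iff
`eRe` is a local ring ("local idempotent"); (21.10) Theorem: «Let `e` be an idempotent in `R`, and `J = rad R`. Then
`rad(eRe) = J ∩ (eRe) = eJe`». This file proves the module-theoretic form of these statements for a mixed `ℚ`-Hodge
structure `H` and its endomorphism algebra `E = End_MHS(H)` (`H.endAlg`; the category of MHS is abelian, Cattani–El
Zein–Griffiths–Lê Thm. 3.2.18, so the image `eH` of an idempotent `e ∈ E` is a sub-MHS and a direct summand,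
`H = eH ⊕ (1-e)H`):

* §1 the image `eH` (`(endAlg.toHom e).range`), `x ∈ eH ↔ e x = x`, `H = eH ⊕ (1 - e)H`; every direct summand `P`
  (`P ⊕ T = H` with `T` a sub-MHS) is `eH` for the idempotent `e = ι_P π_P`.
* §2 **the corner**: extension by zero `endAlg.cornerIncl : End_MHS(eH) →ₙₐ[ℚ] E`, `d ↦ ι d π` (injective, multiplicative,
  `1 ↦ e`, image `= eEe`) and the compression `endAlg.compress : E →ₗ[ℚ] End_MHS(eH)`, `a ↦ e a e|_{eH}` (a retraction,
  `End_MHS(eH)`-bilinear); **`endAlg.cornerRingEquiv : eEe ≃+* End_MHS(eH)`** (Mathlib's `IsIdempotentElem.Corner`).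
* §3 (21.8)–(21.9): **`eH` is indecomposable iff `e ≠ 0` and the only idempotents of `eEe` are `0` and `e`**
  (primitive idempotents), **iff `eEe` is a local ring** (local idempotents; uses the tree's `indecomposable ⇔ End local`).
* §4 (21.10): **`rad End_MHS(eH) = e (rad E) e`**: `ι d π ∈ rad E ↔ d ∈ rad End_MHS(eH)`, the compression maps `rad E`
  into `rad End_MHS(eH)`; hence `rad E = 0 ⟹ rad End_MHS(eH) = 0`, and if `E` is a semisimple ring so is the endomorphism
  algebra of every direct summand of `H`.

All statements proved; the definitions are the displayed maps; no named facts, no instances.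

## References

* [Lam2001FirstCourse] T. Y. Lam, A First Course in Noncommutative Rings, 2nd ed. (2001), §21: (21.3)–(21.4), Prop. (21.6),
  Cor. (21.7), Prop. (21.8), Prop. (21.9), Thm. (21.10) with its proof (galaxy panama:509958646923339, chunks p0284–p0286).
* [CattaniElZeinGriffithsLe2014] E. Cattani et al. (eds.), Hodge Theory (2014), Thm. 3.2.18, Lemma 3.2.20, p. 270.
-/

noncomputable section

namespace Literature.AlgebraicGeometry.Motives

namespace MixedHodgeStructure

open Module

universe u

variable {V : Type u} [AddCommGroup V] [Module ℚ V] {H : MixedHodgeStructure V}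

/-! ### §1 The image `eH` of an idempotent endomorphism -/

/-- **`x ∈ eH ↔ e x = x`** for an idempotent `e ∈ End_MHS(H)`. [cite: Lam2001FirstCourse, (21.4)] -/
theorem endAlg.mem_range_toHom_iff {e : H.endAlg} (he : IsIdempotentElem e) {x : V} :
    x ∈ (endAlg.toHom e).range.toSubmodule ↔ (e : Module.End ℚ V) x = x := by
  rw [Hom.range_toSubmodule, endAlg.toHom_toLinearMap]
  exact LinearMap.IsIdempotentElem.mem_range_iff (congrArg Subtype.val he.eq)

/-- `e` is the identity on `eH`. [cite: Lam2001FirstCourse, (21.4)] -/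
theorem endAlg.apply_coe_range {e : H.endAlg} (he : IsIdempotentElem e) (y : ↥(endAlg.toHom e).range.toSubmodule) :
    (e : Module.End ℚ V) (y : V) = y :=
  (endAlg.mem_range_toHom_iff he).1 y.2

/-- `π ∘ ι = id` on `eH`, where `π : H ↠ eH` is the co-restriction of `e` and `ι : eH ↪ H`. [cite: Lam2001FirstCourse, (21.4)] -/
theorem endAlg.rangeRestrict_apply_coe {e : H.endAlg} (he : IsIdempotentElem e) (y : ↥(endAlg.toHom e).range.toSubmodule) :
    (endAlg.toHom e).rangeRestrict.toLinearMap (y : V) = y :=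
  Subtype.ext (by rw [Hom.coe_rangeRestrict_apply, endAlg.toHom_toLinearMap, endAlg.apply_coe_range he y])

/-- `π (e x) = π x`. [cite: Lam2001FirstCourse, (21.4)] -/
theorem endAlg.rangeRestrict_apply_apply {e : H.endAlg} (he : IsIdempotentElem e) (x : V) :
    (endAlg.toHom e).rangeRestrict.toLinearMap ((e : Module.End ℚ V) x) = (endAlg.toHom e).rangeRestrict.toLinearMap x :=
  Subtype.ext (by
    rw [Hom.coe_rangeRestrict_apply, Hom.coe_rangeRestrict_apply, endAlg.toHom_toLinearMap, ← Module.End.mul_apply,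
      ← Subalgebra.coe_mul, he.eq])

/-- `eH = 0 ↔ e = 0`. [cite: Lam2001FirstCourse, (21.4)] -/
theorem endAlg.range_toHom_eq_bot_iff (e : H.endAlg) : (endAlg.toHom e).range.toSubmodule = ⊥ ↔ e = 0 := by
  rw [Hom.range_toSubmodule, endAlg.toHom_toLinearMap, LinearMap.range_eq_bot]
  exact ⟨fun h => Subtype.ext h, fun h => h ▸ rfl⟩

/-- **`H = eH ⊕ (1 - e)H`** with both summands sub-MHS (`(1 - e)H = Ker e`). [cite: Lam2001FirstCourse, (21.3)]
[cite: CattaniElZeinGriffithsLe2014, Lemma 3.2.20] -/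
theorem endAlg.isCompl_range_range_one_sub {e : H.endAlg} (he : IsIdempotentElem e) :
    IsCompl (endAlg.toHom e).range.toSubmodule (endAlg.toHom (1 - e)).range.toSubmodule := by
  have he' : IsIdempotentElem (e : Module.End ℚ V) := congrArg Subtype.val he.eq
  rw [Hom.range_toSubmodule, Hom.range_toSubmodule, endAlg.toHom_toLinearMap, endAlg.toHom_toLinearMap,
    Subalgebra.coe_sub, OneMemClass.coe_one, ← LinearMap.IsIdempotentElem.ker_eq_range_one_sub he']
  exact LinearMap.IsIdempotentElem.isCompl he'

/-- **Every direct summand is the image of an idempotent**: if `P ⊕ T = H` with sub-MHS `P`, `T`, then `e := ι_P ∘ π_P` (projection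
onto `P` along `T`) is an idempotent of `End_MHS(H)` with `eH = P`. [cite: Lam2001FirstCourse, (21.3)] [cite: CattaniElZeinGriffithsLe2014, Thm. 3.2.18] -/
theorem SubMixedHodgeStructure.exists_isIdempotentElem_range_eq (P T : SubMixedHodgeStructure H)
    (h : IsCompl P.toSubmodule T.toSubmodule) : ∃ e : H.endAlg, IsIdempotentElem e ∧ (endAlg.toHom e).range = P := by
  let π₁ : Hom H P.toMixedHodgeStructure := SubMixedHodgeStructure.projOfIsCompl T P h.symm
  have hπ : ∀ y : ↥P.toSubmodule, π₁.toLinearMap (y : V) = y := fun y =>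
    SubMixedHodgeStructure.projOfIsCompl_apply_of_mem_right T P h.symm y
  refine ⟨(P.subtype.comp π₁).toEndAlg, Subtype.ext (LinearMap.ext fun x => ?_), SubMixedHodgeStructure.ext ?_⟩
  · change ((π₁.toLinearMap ((π₁.toLinearMap x : ↥P.toSubmodule) : V) : ↥P.toSubmodule) : V) = (π₁.toLinearMap x : V)
    rw [hπ]
  · rw [Hom.range_toSubmodule]
    refine le_antisymm ?_ fun x hx => ⟨x, ?_⟩
    · rintro _ ⟨x, rfl⟩
      exact (π₁.toLinearMap x).2
    · change ((π₁.toLinearMap x : ↥P.toSubmodule) : V) = x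
      rw [show x = ((⟨x, hx⟩ : ↥P.toSubmodule) : V) from rfl, hπ]

/-! ### §2 The corner `e E e` and `End_MHS(eH)` -/

/-- **Extension by zero `d ↦ ι ∘ d ∘ π`**: a non-unital homomorphism of `ℚ`-algebras `End_MHS(eH) → End_MHS(H)` (the inverse of
Lam's `λ`, composed with `End_R(eR) ≅ eRe ⊆ R`). [cite: Lam2001FirstCourse, Cor. (21.7)] -/
def endAlg.cornerIncl {e : H.endAlg} (he : IsIdempotentElem e) :
    (endAlg.toHom e).range.toMixedHodgeStructure.endAlg →ₙₐ[ℚ] H.endAlg where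
  toFun d := ((endAlg.toHom e).range.subtype.comp ((endAlg.toHom d).comp (endAlg.toHom e).rangeRestrict)).toEndAlg
  map_smul' q d := by
    refine Subtype.ext (LinearMap.ext fun x => ?_)
    change ((((q • d : (endAlg.toHom e).range.toMixedHodgeStructure.endAlg) : Module.End ℚ ↥(endAlg.toHom e).range.toSubmodule)
        ((endAlg.toHom e).rangeRestrict.toLinearMap x) : ↥(endAlg.toHom e).range.toSubmodule) : V) =
      q • (((d : Module.End ℚ ↥(endAlg.toHom e).range.toSubmodule) ((endAlg.toHom e).rangeRestrict.toLinearMap x) :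
        ↥(endAlg.toHom e).range.toSubmodule) : V)
    rw [Subalgebra.coe_smul, LinearMap.smul_apply, Submodule.coe_smul]
  map_zero' := by
    refine Subtype.ext (LinearMap.ext fun x => ?_)
    change ((((0 : (endAlg.toHom e).range.toMixedHodgeStructure.endAlg) : Module.End ℚ ↥(endAlg.toHom e).range.toSubmodule)
        ((endAlg.toHom e).rangeRestrict.toLinearMap x) : ↥(endAlg.toHom e).range.toSubmodule) : V) = 0
    rw [ZeroMemClass.coe_zero, LinearMap.zero_apply, ZeroMemClass.coe_zero]
  map_add' d d' := by
    refine Subtype.ext (LinearMap.ext fun x => ?_)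
    change ((((d + d' : (endAlg.toHom e).range.toMixedHodgeStructure.endAlg) : Module.End ℚ ↥(endAlg.toHom e).range.toSubmodule)
        ((endAlg.toHom e).rangeRestrict.toLinearMap x) : ↥(endAlg.toHom e).range.toSubmodule) : V) =
      (((d : Module.End ℚ ↥(endAlg.toHom e).range.toSubmodule) ((endAlg.toHom e).rangeRestrict.toLinearMap x) :
        ↥(endAlg.toHom e).range.toSubmodule) : V) +
      (((d' : Module.End ℚ ↥(endAlg.toHom e).range.toSubmodule) ((endAlg.toHom e).rangeRestrict.toLinearMap x) :
        ↥(endAlg.toHom e).range.toSubmodule) : V)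
    rw [Subalgebra.coe_add, LinearMap.add_apply, Submodule.coe_add]
  map_mul' d d' := by
    refine Subtype.ext (LinearMap.ext fun x => ?_)
    change ((((d * d' : (endAlg.toHom e).range.toMixedHodgeStructure.endAlg) : Module.End ℚ ↥(endAlg.toHom e).range.toSubmodule)
        ((endAlg.toHom e).rangeRestrict.toLinearMap x) : ↥(endAlg.toHom e).range.toSubmodule) : V) =
      (((d : Module.End ℚ ↥(endAlg.toHom e).range.toSubmodule) ((endAlg.toHom e).rangeRestrict.toLinearMap
        ((((d' : Module.End ℚ ↥(endAlg.toHom e).range.toSubmodule) ((endAlg.toHom e).rangeRestrict.toLinearMap x) :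
          ↥(endAlg.toHom e).range.toSubmodule) : V))) : ↥(endAlg.toHom e).range.toSubmodule) : V)
    rw [endAlg.rangeRestrict_apply_coe he, Subalgebra.coe_mul, Module.End.mul_apply]

/-- `(ι d π) x = d (π x)` (by `rfl`). [cite: Lam2001FirstCourse, Cor. (21.7)] -/
@[simp]
theorem endAlg.coe_cornerIncl_apply {e : H.endAlg} (he : IsIdempotentElem e)
    (d : (endAlg.toHom e).range.toMixedHodgeStructure.endAlg) (x : V) :
    ((endAlg.cornerIncl he d : H.endAlg) : Module.End ℚ V) x =
      (((d : Module.End ℚ ↥(endAlg.toHom e).range.toSubmodule) ((endAlg.toHom e).rangeRestrict.toLinearMap x) :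
        ↥(endAlg.toHom e).range.toSubmodule) : V) := rfl

/-- **`ι 1 π = e`.** [cite: Lam2001FirstCourse, Cor. (21.7)] -/
theorem endAlg.cornerIncl_one {e : H.endAlg} (he : IsIdempotentElem e) : endAlg.cornerIncl he 1 = e :=
  Subtype.ext (LinearMap.ext fun x => by
    rw [endAlg.coe_cornerIncl_apply, OneMemClass.coe_one, Module.End.one_apply, Hom.coe_rangeRestrict_apply,
      endAlg.toHom_toLinearMap])

/-- `e (ι d π) = ι d π`. [cite: Lam2001FirstCourse, (21.4)] -/
theorem endAlg.mul_cornerIncl {e : H.endAlg} (he : IsIdempotentElem e) (d : (endAlg.toHom e).range.toMixedHodgeStructure.endAlg) :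
    e * endAlg.cornerIncl he d = endAlg.cornerIncl he d :=
  Subtype.ext (LinearMap.ext fun x => by
    rw [Subalgebra.coe_mul, Module.End.mul_apply, endAlg.coe_cornerIncl_apply, endAlg.apply_coe_range he])

/-- `(ι d π) e = ι d π`. [cite: Lam2001FirstCourse, (21.4)] -/
theorem endAlg.cornerIncl_mul {e : H.endAlg} (he : IsIdempotentElem e) (d : (endAlg.toHom e).range.toMixedHodgeStructure.endAlg) :
    endAlg.cornerIncl he d * e = endAlg.cornerIncl he d :=
  Subtype.ext (LinearMap.ext fun x => by
    rw [Subalgebra.coe_mul, Module.End.mul_apply, endAlg.coe_cornerIncl_apply, endAlg.coe_cornerIncl_apply,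
      endAlg.rangeRestrict_apply_apply he])

/-- **`ι d π` lies in the corner `e E e`.** [cite: Lam2001FirstCourse, (21.4) and Cor. (21.7)] -/
theorem endAlg.cornerIncl_mem_corner {e : H.endAlg} (he : IsIdempotentElem e)
    (d : (endAlg.toHom e).range.toMixedHodgeStructure.endAlg) : endAlg.cornerIncl he d ∈ Subsemigroup.corner e :=
  (Subsemigroup.mem_corner_iff he).2 ⟨endAlg.mul_cornerIncl he d, endAlg.cornerIncl_mul he d⟩

/-- `d ↦ ι d π` is injective. [cite: Lam2001FirstCourse, Cor. (21.7)] -/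
theorem endAlg.cornerIncl_injective {e : H.endAlg} (he : IsIdempotentElem e) : Function.Injective (endAlg.cornerIncl he) :=
  fun d d' hdd => Subtype.ext (LinearMap.ext fun y => Subtype.ext (by
    have h := congrArg (fun a : H.endAlg => (a : Module.End ℚ V) (y : V)) hdd
    simpa only [endAlg.coe_cornerIncl_apply, endAlg.rangeRestrict_apply_coe he] using h))

/-- **The compression `a ↦ e a e|_{eH}`**, a `ℚ`-linear map `End_MHS(H) → End_MHS(eH)`, `y ↦ e (a y)` for `y ∈ eH` (Lam's `λ`
on the corner). [cite: Lam2001FirstCourse, Prop. (21.6) and Cor. (21.7)] -/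
def endAlg.compress (e : H.endAlg) :
    H.endAlg →ₗ[ℚ] (endAlg.toHom e).range.toMixedHodgeStructure.endAlg where
  toFun a := ((endAlg.toHom e).rangeRestrict.comp ((endAlg.toHom a).comp (endAlg.toHom e).range.subtype)).toEndAlg
  map_add' a b := by
    refine Subtype.ext (LinearMap.ext fun y => Subtype.ext ?_)
    change (e : Module.End ℚ V) (((a + b : H.endAlg) : Module.End ℚ V) (y : V)) =
      (e : Module.End ℚ V) ((a : Module.End ℚ V) (y : V)) + (e : Module.End ℚ V) ((b : Module.End ℚ V) (y : V))
    rw [Subalgebra.coe_add, LinearMap.add_apply, map_add]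
  map_smul' q a := by
    refine Subtype.ext (LinearMap.ext fun y => Subtype.ext ?_)
    change (e : Module.End ℚ V) (((q • a : H.endAlg) : Module.End ℚ V) (y : V)) =
      q • (e : Module.End ℚ V) ((a : Module.End ℚ V) (y : V))
    rw [Subalgebra.coe_smul, LinearMap.smul_apply, map_smul]

/-- `compress a y = e (a y)` on underlying vectors (by `rfl`). [cite: Lam2001FirstCourse, Prop. (21.6)] -/
@[simp]
theorem endAlg.coe_compress_apply (e a : H.endAlg) (y : ↥(endAlg.toHom e).range.toSubmodule) :
    ((((endAlg.compress e a : (endAlg.toHom e).range.toMixedHodgeStructure.endAlg) :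
        Module.End ℚ ↥(endAlg.toHom e).range.toSubmodule) y : ↥(endAlg.toHom e).range.toSubmodule) : V) =
      (e : Module.End ℚ V) ((a : Module.End ℚ V) (y : V)) := rfl

/-- **`compress (ι d π) = d`**: the compression is a retraction of the extension by zero. [cite: Lam2001FirstCourse, Cor. (21.7)] -/
theorem endAlg.compress_cornerIncl {e : H.endAlg} (he : IsIdempotentElem e) (d : (endAlg.toHom e).range.toMixedHodgeStructure.endAlg) :
    endAlg.compress e (endAlg.cornerIncl he d) = d :=
  Subtype.ext (LinearMap.ext fun y => Subtype.ext (by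
    rw [endAlg.coe_compress_apply, endAlg.coe_cornerIncl_apply, endAlg.rangeRestrict_apply_coe he, endAlg.apply_coe_range he]))

/-- **`ι (compress a) π = e a e`.** [cite: Lam2001FirstCourse, (21.3) and Cor. (21.7)] -/
theorem endAlg.cornerIncl_compress {e : H.endAlg} (he : IsIdempotentElem e) (a : H.endAlg) :
    endAlg.cornerIncl he (endAlg.compress e a) = e * a * e :=
  Subtype.ext (LinearMap.ext fun x => by
    rw [endAlg.coe_cornerIncl_apply, endAlg.coe_compress_apply, Hom.coe_rangeRestrict_apply, endAlg.toHom_toLinearMap,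
      Subalgebra.coe_mul, Subalgebra.coe_mul, Module.End.mul_apply, Module.End.mul_apply])

/-- On the corner the two maps are mutually inverse: `ι (compress a) π = a` for `a ∈ e E e`. [cite: Lam2001FirstCourse, Cor. (21.7)] -/
theorem endAlg.cornerIncl_compress_of_mem {e : H.endAlg} (he : IsIdempotentElem e) {a : H.endAlg}
    (ha : a ∈ Subsemigroup.corner e) : endAlg.cornerIncl he (endAlg.compress e a) = a := by
  obtain ⟨h1, h2⟩ := (Subsemigroup.mem_corner_iff he).1 ha
  rw [endAlg.cornerIncl_compress, h1, h2]

/-- The corner `e E e` is exactly the image of `d ↦ ι d π`. [cite: Lam2001FirstCourse, (21.4) and Cor. (21.7)] -/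
theorem endAlg.mem_corner_iff_exists_cornerIncl {e : H.endAlg} (he : IsIdempotentElem e) (a : H.endAlg) :
    a ∈ Subsemigroup.corner e ↔ ∃ d, endAlg.cornerIncl he d = a :=
  ⟨fun ha => ⟨_, endAlg.cornerIncl_compress_of_mem he ha⟩, fun ⟨d, hd⟩ => hd ▸ endAlg.cornerIncl_mem_corner he d⟩

/-- `compress 1 = 1`. [cite: Lam2001FirstCourse, Cor. (21.7)] -/
theorem endAlg.compress_one {e : H.endAlg} (he : IsIdempotentElem e) : endAlg.compress e 1 = 1 :=
  Subtype.ext (LinearMap.ext fun y => Subtype.ext (by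
    rw [endAlg.coe_compress_apply, OneMemClass.coe_one, Module.End.one_apply, endAlg.apply_coe_range he,
      OneMemClass.coe_one, Module.End.one_apply]))

/-- `compress e = 1`. [cite: Lam2001FirstCourse, Cor. (21.7)] -/
theorem endAlg.compress_self {e : H.endAlg} (he : IsIdempotentElem e) : endAlg.compress e e = 1 := by
  have h := endAlg.compress_cornerIncl he 1
  rwa [endAlg.cornerIncl_one] at h

/-- **`compress` is right `End_MHS(eH)`-linear: `compress (a · ι d π) = compress a · d`.** [cite: Lam2001FirstCourse, Prop. (21.6)] -/
theorem endAlg.compress_mul_cornerIncl {e : H.endAlg} (he : IsIdempotentElem e) (a : H.endAlg)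
    (d : (endAlg.toHom e).range.toMixedHodgeStructure.endAlg) :
    endAlg.compress e (a * endAlg.cornerIncl he d) = endAlg.compress e a * d :=
  Subtype.ext (LinearMap.ext fun y => Subtype.ext (by
    rw [endAlg.coe_compress_apply, Subalgebra.coe_mul, Module.End.mul_apply, endAlg.coe_cornerIncl_apply,
      endAlg.rangeRestrict_apply_coe he, Subalgebra.coe_mul, Module.End.mul_apply, endAlg.coe_compress_apply]))

/-- **`compress` is left `End_MHS(eH)`-linear: `compress (ι d π · a) = d · compress a`.** [cite: Lam2001FirstCourse, Prop. (21.6)] -/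
theorem endAlg.compress_cornerIncl_mul {e : H.endAlg} (he : IsIdempotentElem e)
    (d : (endAlg.toHom e).range.toMixedHodgeStructure.endAlg) (a : H.endAlg) :
    endAlg.compress e (endAlg.cornerIncl he d * a) = d * endAlg.compress e a :=
  Subtype.ext (LinearMap.ext fun y => Subtype.ext (by
    rw [endAlg.coe_compress_apply, Subalgebra.coe_mul, Module.End.mul_apply, endAlg.coe_cornerIncl_apply,
      endAlg.apply_coe_range he, Subalgebra.coe_mul, Module.End.mul_apply]
    rfl))

/-- `compress (a b) = compress a · compress b` whenever `b ∈ e E e`. [cite: Lam2001FirstCourse, Cor. (21.7)] -/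
theorem endAlg.compress_mul_of_mem_corner {e : H.endAlg} (he : IsIdempotentElem e) (a : H.endAlg) {b : H.endAlg}
    (hb : b ∈ Subsemigroup.corner e) : endAlg.compress e (a * b) = endAlg.compress e a * endAlg.compress e b := by
  conv_lhs => rw [← endAlg.cornerIncl_compress_of_mem he hb]
  rw [endAlg.compress_mul_cornerIncl]

/-- **`e E e ≅ End_MHS(eH)` as rings** (the module-theoretic form of Lam's `End_R(eR) ≅ eRe`): the compression restricted to the
corner, with inverse the extension by zero. [cite: Lam2001FirstCourse, Cor. (21.7)] [cite: CattaniElZeinGriffithsLe2014, Thm. 3.2.18] -/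
def endAlg.cornerRingEquiv {e : H.endAlg} (he : IsIdempotentElem e) :
    he.Corner ≃+* (endAlg.toHom e).range.toMixedHodgeStructure.endAlg where
  toFun c := endAlg.compress e c.1
  invFun d := ⟨endAlg.cornerIncl he d, endAlg.cornerIncl_mem_corner he d⟩
  left_inv c := Subtype.ext (endAlg.cornerIncl_compress_of_mem he c.2)
  right_inv d := endAlg.compress_cornerIncl he d
  map_mul' _ c' := endAlg.compress_mul_of_mem_corner he _ c'.2
  map_add' c c' := map_add (endAlg.compress e) c.1 c'.1

/-- `cornerRingEquiv c = compress c` (by `rfl`). [cite: Lam2001FirstCourse, Cor. (21.7)] -/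
theorem endAlg.cornerRingEquiv_apply {e : H.endAlg} (he : IsIdempotentElem e) (c : he.Corner) :
    endAlg.cornerRingEquiv he c = endAlg.compress e c.1 := rfl

/-- `(cornerRingEquiv⁻¹ d) = ι d π` (by `rfl`). [cite: Lam2001FirstCourse, Cor. (21.7)] -/
theorem endAlg.coe_cornerRingEquiv_symm_apply {e : H.endAlg} (he : IsIdempotentElem e)
    (d : (endAlg.toHom e).range.toMixedHodgeStructure.endAlg) :
    ((endAlg.cornerRingEquiv he).symm d).1 = endAlg.cornerIncl he d := rfl

/-- `dim_ℚ End_MHS(eH) ≤ dim_ℚ End_MHS(H)` (the corner is a subspace). [cite: Lam2001FirstCourse, (21.3)] -/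
theorem endAlg.finrank_endAlg_range_le [FiniteDimensional ℚ V] {e : H.endAlg} (he : IsIdempotentElem e) :
    finrank ℚ (endAlg.toHom e).range.toMixedHodgeStructure.endAlg ≤ finrank ℚ H.endAlg := by
  haveI := finiteDimensional_endAlg H
  let L : (endAlg.toHom e).range.toMixedHodgeStructure.endAlg →ₗ[ℚ] H.endAlg :=
    { toFun := endAlg.cornerIncl he, map_add' := map_add _, map_smul' := fun q d => map_smul _ q d }
  exact LinearMap.finrank_le_finrank_of_injective (f := L) (endAlg.cornerIncl_injective he)

/-! ### §3 Primitive and local idempotents: (21.8) and (21.9) -/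

/-- Idempotents of the corner correspond to idempotents of `End_MHS(eH)`. [cite: Lam2001FirstCourse, Prop. (21.8)] -/
theorem endAlg.isIdempotentElem_compress_of_mem_corner {e : H.endAlg} (he : IsIdempotentElem e) {a : H.endAlg}
    (ha : a ∈ Subsemigroup.corner e) (hi : IsIdempotentElem a) : IsIdempotentElem (endAlg.compress e a) := by
  have h := endAlg.compress_mul_of_mem_corner he a ha
  rw [hi.eq] at h
  exact (h.symm : endAlg.compress e a * endAlg.compress e a = endAlg.compress e a)

/-- **(21.8) `eH` is indecomposable iff `e` is a primitive idempotent**: `e ≠ 0` and the corner `e E e` has no idempotents other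
than `0` and `e`. [cite: Lam2001FirstCourse, Prop. (21.8)] [cite: CattaniElZeinGriffithsLe2014, p. 270] -/
theorem endAlg.isIndecomposable_range_iff [FiniteDimensional ℚ V] {e : H.endAlg} (he : IsIdempotentElem e) :
    (endAlg.toHom e).range.toMixedHodgeStructure.IsIndecomposable ↔
      e ≠ 0 ∧ ∀ a ∈ Subsemigroup.corner e, IsIdempotentElem a → a = 0 ∨ a = e := by
  rw [isIndecomposable_iff_forall_isIdempotentElem, Submodule.nontrivial_iff_ne_bot, Ne, endAlg.range_toHom_eq_bot_iff]
  refine and_congr Iff.rfl ⟨fun h a ha hi => ?_, fun h d hd => ?_⟩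
  · rcases h _ (endAlg.isIdempotentElem_compress_of_mem_corner he ha hi) with h0 | h1
    · left
      rw [← endAlg.cornerIncl_compress_of_mem he ha, h0, map_zero]
    · right
      rw [← endAlg.cornerIncl_compress_of_mem he ha, h1, endAlg.cornerIncl_one]
  · have hi : IsIdempotentElem (endAlg.cornerIncl he d) := by
      change endAlg.cornerIncl he d * endAlg.cornerIncl he d = endAlg.cornerIncl he d
      rw [← map_mul, hd.eq]
    rcases h _ (endAlg.cornerIncl_mem_corner he d) hi with h0 | h1
    · left
      rw [← endAlg.compress_cornerIncl he d, h0, map_zero]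
    · right
      rw [← endAlg.compress_cornerIncl he d, h1, endAlg.compress_self he]

/-- Local rings transport along ring isomorphisms (non-commutative). [cite: Lam2001FirstCourse, (19.1)] -/
private theorem isLocalRing_of_ringEquiv {A B : Type*} [Semiring A] [Semiring B] (f : A ≃+* B) (hA : IsLocalRing A) :
    IsLocalRing B := by
  haveI := hA
  haveI : Nontrivial B := f.injective.nontrivial
  refine IsLocalRing.of_is_unit_or_is_unit_of_add_one fun {a b} hab => ?_
  have h : f.symm a + f.symm b = 1 := by rw [← map_add, hab, map_one]
  rcases IsLocalRing.isUnit_or_isUnit_of_add_one h with ha | hb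
  · exact Or.inl (by simpa using ha.map f)
  · exact Or.inr (by simpa using hb.map f)

/-- **(21.9) `eH` is indecomposable iff `e` is a local idempotent**: the corner ring `e E e` is local (indecomposable MHS have
local endomorphism rings, Lam (19.17), and `e E e ≅ End_MHS(eH)`). [cite: Lam2001FirstCourse, Prop. (21.9) and Thm. (19.17)] -/
theorem endAlg.isIndecomposable_range_iff_isLocalRing_corner [FiniteDimensional ℚ V] {e : H.endAlg} (he : IsIdempotentElem e) :
    (endAlg.toHom e).range.toMixedHodgeStructure.IsIndecomposable ↔ IsLocalRing he.Corner := by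
  rw [isIndecomposable_iff_isLocalRing]
  exact ⟨fun h => isLocalRing_of_ringEquiv (endAlg.cornerRingEquiv he).symm h,
    fun h => isLocalRing_of_ringEquiv (endAlg.cornerRingEquiv he) h⟩

/-- For a local idempotent `e` every element of the corner is a unit of `e E e` or nilpotent. [cite: Lam2001FirstCourse, Prop. (21.9) and Thm. (19.17)] -/
theorem endAlg.isUnit_or_isNilpotent_compress [FiniteDimensional ℚ V] {e : H.endAlg}
    (h : (endAlg.toHom e).range.toMixedHodgeStructure.IsIndecomposable) (a : H.endAlg) :
    IsUnit (endAlg.compress e a) ∨ IsNilpotent (endAlg.compress e a) :=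
  h.isUnit_or_isNilpotent _

/-! ### §4 The Jacobson radical of the corner: (21.10) `rad End_MHS(eH) = e (rad E) e` -/

/-- **(21.10), inclusion `eJe ⊆ rad(eEe)`**: if `ι d π ∈ rad End_MHS(H)` then `d ∈ rad End_MHS(eH)` (Lam: for `y ∈ eRe` a left inverse
`x` of `1 - yr` in `R` gives the left inverse `exe` of `e - yr` in `eRe`). [cite: Lam2001FirstCourse, Thm. (21.10) (proof, (3))] -/
theorem endAlg.mem_jacobson_of_cornerIncl_mem {e : H.endAlg} (he : IsIdempotentElem e)
    {d : (endAlg.toHom e).range.toMixedHodgeStructure.endAlg} (hd : endAlg.cornerIncl he d ∈ Ring.jacobson H.endAlg) :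
    d ∈ Ring.jacobson (endAlg.toHom e).range.toMixedHodgeStructure.endAlg := by
  rw [← Ideal.jacobson_bot, Ideal.mem_jacobson_iff] at hd ⊢
  intro y
  obtain ⟨x, hx⟩ := hd (endAlg.cornerIncl he y)
  rw [Ideal.mem_bot] at hx
  refine ⟨endAlg.compress e x, ?_⟩
  rw [Ideal.mem_bot]
  -- compress the identity `x (ι y π) (ι d π) + x - 1 = 0`
  have h := congrArg (endAlg.compress e) hx
  rwa [map_zero, map_sub, map_add, endAlg.compress_one he, mul_assoc, ← map_mul, endAlg.compress_mul_cornerIncl,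
    ← mul_assoc] at h

/-- **(21.10), inclusion `rad(eEe) ⊆ J`**: if `d ∈ rad End_MHS(eH)` then `ι d π ∈ rad End_MHS(H)` (Lam: `b(1 - yr) = e` in `eRe` gives
`(1 + yrb)(1 - yr) = 1`). [cite: Lam2001FirstCourse, Thm. (21.10) (proof, (1))] -/
theorem endAlg.cornerIncl_mem_jacobson_of_mem {e : H.endAlg} (he : IsIdempotentElem e)
    {d : (endAlg.toHom e).range.toMixedHodgeStructure.endAlg} (hd : d ∈ Ring.jacobson (endAlg.toHom e).range.toMixedHodgeStructure.endAlg) :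
    endAlg.cornerIncl he d ∈ Ring.jacobson H.endAlg := by
  rw [← Ideal.jacobson_bot, Ideal.mem_jacobson_iff] at hd ⊢
  intro y
  obtain ⟨b, hb⟩ := hd (endAlg.compress e y)
  rw [Ideal.mem_bot] at hb
  -- `b' (y r + 1) = e` for `b' = ι b π`, `r = ι d π`
  have hb' : endAlg.cornerIncl he b * (y * endAlg.cornerIncl he d + 1) = e := by
    have h := congrArg (endAlg.cornerIncl he) hb
    rw [map_zero, map_sub, map_add, endAlg.cornerIncl_one, sub_eq_zero, map_mul, map_mul,
      endAlg.cornerIncl_compress] at h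
    -- `h : ι b π * (e * y * e) * ι d π + ι b π = e`; absorb the two `e`'s into the corner elements
    have h2 : endAlg.cornerIncl he b * (e * y * e) * endAlg.cornerIncl he d =
        endAlg.cornerIncl he b * y * endAlg.cornerIncl he d := by
      calc endAlg.cornerIncl he b * (e * y * e) * endAlg.cornerIncl he d
          = (endAlg.cornerIncl he b * e) * y * (e * endAlg.cornerIncl he d) := by simp only [mul_assoc]
        _ = endAlg.cornerIncl he b * y * endAlg.cornerIncl he d := by rw [endAlg.cornerIncl_mul, endAlg.mul_cornerIncl]
    rw [h2] at h
    rw [mul_add, mul_one, ← mul_assoc]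
    exact h
  refine ⟨1 - y * endAlg.cornerIncl he d * endAlg.cornerIncl he b, ?_⟩
  rw [Ideal.mem_bot]
  -- `(1 - y r b')(y r + 1) = y r + 1 - y r (b' (y r + 1)) = y r + 1 - y r e = 1`
  have h3 : (1 - y * endAlg.cornerIncl he d * endAlg.cornerIncl he b) * (y * endAlg.cornerIncl he d + 1) = 1 := by
    rw [sub_mul, one_mul, mul_assoc (y * endAlg.cornerIncl he d) (endAlg.cornerIncl he b), hb',
      mul_assoc y (endAlg.cornerIncl he d) e, endAlg.cornerIncl_mul, add_sub_cancel_left]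
  calc (1 - y * endAlg.cornerIncl he d * endAlg.cornerIncl he b) * y * endAlg.cornerIncl he d +
        (1 - y * endAlg.cornerIncl he d * endAlg.cornerIncl he b) - 1
      = (1 - y * endAlg.cornerIncl he d * endAlg.cornerIncl he b) * (y * endAlg.cornerIncl he d + 1) - 1 := by
        rw [mul_add, mul_one, ← mul_assoc]
    _ = 0 := by rw [h3, sub_self]

/-- **(21.10) `rad End_MHS(eH) = e (rad End_MHS(H)) e`**: `ι d π ∈ rad End_MHS(H) ↔ d ∈ rad End_MHS(eH)`.
[cite: Lam2001FirstCourse, Thm. (21.10)] -/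
theorem endAlg.cornerIncl_mem_jacobson_iff {e : H.endAlg} (he : IsIdempotentElem e)
    (d : (endAlg.toHom e).range.toMixedHodgeStructure.endAlg) :
    endAlg.cornerIncl he d ∈ Ring.jacobson H.endAlg ↔ d ∈ Ring.jacobson (endAlg.toHom e).range.toMixedHodgeStructure.endAlg :=
  ⟨endAlg.mem_jacobson_of_cornerIncl_mem he, endAlg.cornerIncl_mem_jacobson_of_mem he⟩

/-- **The compression maps `rad End_MHS(H)` into `rad End_MHS(eH)`** (`e J e ⊆ rad(eEe)`). [cite: Lam2001FirstCourse, Thm. (21.10)] -/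
theorem endAlg.compress_mem_jacobson {e : H.endAlg} (he : IsIdempotentElem e) {a : H.endAlg} (ha : a ∈ Ring.jacobson H.endAlg) :
    endAlg.compress e a ∈ Ring.jacobson (endAlg.toHom e).range.toMixedHodgeStructure.endAlg := by
  refine endAlg.mem_jacobson_of_cornerIncl_mem he ?_
  rw [endAlg.cornerIncl_compress]
  exact Ideal.mul_mem_right _ _ (Ideal.mul_mem_left _ _ ha)

/-- Every element of `rad End_MHS(eH)` is the compression of an element of `rad End_MHS(H)` (namely of `ι d π`).
[cite: Lam2001FirstCourse, Thm. (21.10)] -/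
theorem endAlg.exists_compress_eq_of_mem_jacobson {e : H.endAlg} (he : IsIdempotentElem e)
    {d : (endAlg.toHom e).range.toMixedHodgeStructure.endAlg} (hd : d ∈ Ring.jacobson (endAlg.toHom e).range.toMixedHodgeStructure.endAlg) :
    ∃ a ∈ Ring.jacobson H.endAlg, endAlg.compress e a = d :=
  ⟨_, endAlg.cornerIncl_mem_jacobson_of_mem he hd, endAlg.compress_cornerIncl he d⟩

/-- **`rad End_MHS(H) = 0 ⟹ rad End_MHS(eH) = 0`** for every idempotent `e`. [cite: Lam2001FirstCourse, Thm. (21.10)] -/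
theorem endAlg.jacobson_endAlg_range_eq_bot {e : H.endAlg} (he : IsIdempotentElem e) (h : Ring.jacobson H.endAlg = ⊥) :
    Ring.jacobson (endAlg.toHom e).range.toMixedHodgeStructure.endAlg = ⊥ := by
  rw [eq_bot_iff]
  intro d hd
  have h1 := endAlg.cornerIncl_mem_jacobson_of_mem he hd
  rw [h, Ideal.mem_bot] at h1
  rw [Ideal.mem_bot, ← endAlg.compress_cornerIncl he d, h1, map_zero]

/-- **If `End_MHS(H)` is a semisimple ring, so is `End_MHS(eH)`** for every idempotent `e` (Artinian with zero radical).
[cite: Lam2001FirstCourse, Thm. (21.10) and Cor. (21.13)] -/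
theorem endAlg.isSemisimpleRing_endAlg_range [FiniteDimensional ℚ V] {e : H.endAlg} (he : IsIdempotentElem e)
    (h : IsSemisimpleRing H.endAlg) : IsSemisimpleRing (endAlg.toHom e).range.toMixedHodgeStructure.endAlg := by
  haveI := isArtinianRing_endAlg H
  haveI := isArtinianRing_endAlg (endAlg.toHom e).range.toMixedHodgeStructure
  exact IsArtinianRing.isSemisimpleRing_iff_jacobson.2
    (endAlg.jacobson_endAlg_range_eq_bot he (IsArtinianRing.isSemisimpleRing_iff_jacobson.1 h))

/-- **Direct summands of an MHS with semisimple endomorphism ring have semisimple endomorphism rings**: if `P ⊕ T = H` and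
`End_MHS(H)` is a semisimple ring then so is `End_MHS(P)`. [cite: Lam2001FirstCourse, Thm. (21.10)] [cite: CattaniElZeinGriffithsLe2014, Thm. 3.2.18] -/
theorem SubMixedHodgeStructure.isSemisimpleRing_endAlg_of_isCompl [FiniteDimensional ℚ V] (P T : SubMixedHodgeStructure H)
    (hPT : IsCompl P.toSubmodule T.toSubmodule) (h : IsSemisimpleRing H.endAlg) :
    IsSemisimpleRing P.toMixedHodgeStructure.endAlg := by
  obtain ⟨e, he, hP⟩ := SubMixedHodgeStructure.exists_isIdempotentElem_range_eq P T hPT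
  subst hP
  exact endAlg.isSemisimpleRing_endAlg_range he h

/-- Likewise **direct summands inherit indecomposability criteria through the corner**: `P` (with a complement `T`) is indecomposable
iff the corner of the projection `e = ι_P π_P` is a local ring. [cite: Lam2001FirstCourse, Prop. (21.9)] -/
theorem SubMixedHodgeStructure.isIndecomposable_iff_exists_isLocalRing_corner [FiniteDimensional ℚ V]
    (P T : SubMixedHodgeStructure H) (hPT : IsCompl P.toSubmodule T.toSubmodule) :
    P.toMixedHodgeStructure.IsIndecomposable ↔
      ∃ (e : H.endAlg) (he : IsIdempotentElem e), (endAlg.toHom e).range = P ∧ IsLocalRing he.Corner := by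
  constructor
  · intro hP
    obtain ⟨e, he, hP'⟩ := SubMixedHodgeStructure.exists_isIdempotentElem_range_eq P T hPT
    refine ⟨e, he, hP', ?_⟩
    subst hP'
    exact (endAlg.isIndecomposable_range_iff_isLocalRing_corner he).1 hP
  · rintro ⟨e, he, hP', hl⟩
    subst hP'
    exact (endAlg.isIndecomposable_range_iff_isLocalRing_corner he).2 hl

end MixedHodgeStructure

end Literature.AlgebraicGeometry.Motives
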